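import Mathlib
import Summits.NavierStokesRegularity.NavierStokesRegularity.Theorems.WakeRatchetTailRatchetRelayBorderedGeneral
import Summits.NavierStokesRegularity.NavierStokesRegularity.Theorems.WakeRatchetTailRatchetRelaySolvabilityExplicit
import HarnessLib

/-!
# `WakeRatchet.TailRatchet` (stmt-NavierStokesRegularity-21808): EXPLICIT OPERATOR BOUND for the
# drain-bordered inverse `M⁻¹ : φ ↦ (h, ε)`, `L₀h + ε·8e^{3t} = φ`, in the weighted class `|φ| ≤ A e^{t/2}`

Support file for the crux `TailRatchet` (route `WakeRatchet`; MODEL lattice ODEs of Tao 2016 §1.2, §4 —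
nothing in this file is a statement about the Navier–Stokes equations, and no item is closed here).

Context (census of stmt-21808, programme "R-lac", assembly of the nonlinear step): the quasi-Newton
contraction `(h,δ) ↦ −M⁻¹[Res_s + (L_s−L₀)h − Q_s(h) + δ(D_s(h) − 8e^{3t})]` needs the drain-bordered inverse
`M⁻¹` (`…RelayBorderedGeneral.drain_bordered_exists/unique`) with explicit bounds between the weighted
classes `Y_{1/2} = {|φ| ≤ Ae^{t/2}}` and `X_{1/2} = {|h|,|h'| ≲ e^{t/2}}`.  This file supplies them, sorry-free:

* `drain_functional_le` — quantitative transversality in the drain direction: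
  `∫_{(−∞,0]} w₁·8e^{3t} ≤ −3/10` (so `|ℓ_δ| ≥ 3/10`);
* `weighted_integrable`, `adjoint_pairing_abs_le` — `|φ| ≤ Ae^{t/2}` ⇒ `∫_{(−∞,0]}|φ| ≤ 2A`, and `|∫w₁φ| ≤ 142A`;
* `drain_bordered_inverse_bound` — **for `φ` continuous with `|φ(t)| ≤ Ae^{t/2}` (`t ≤ 0`) there are `ε`, `h`
  with `L₀h + ε·8e^{3t} = φ` on `t<0`, `h(0) = 0`, `h(−∞) = 0`, and
  `|ε| ≤ 474A`, `|h(t)| ≤ K₁A·e^{t/2}`, `|2e^{t/2}h(t/2) + φ(t) − ε8e^{3t}| ≤ K₂A·e^{t/2}`**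
  with explicit numerical `K₁, K₂` (uniqueness: `…RelayBorderedGeneral.drain_bordered_unique`).

HONEST FRAMING: bookkeeping of explicit constants; MODEL lattice only; the construction item and the crux
stay open; lacunary fronts do NOT refute `TailRatchet` (which needs `Λ → 1`).
-/

noncomputable section

set_option linter.dupNamespace false

namespace Summit.NavierStokesRegularity.NavierStokesRegularity.Theorems

namespace WakeRatchetRelayInverseBound

open MeasureTheory Set Filter Topology Real
open WakeRatchetRelayAdjoint WakeRatchetRelayTransversality WakeRatchetRelayGreen
  WakeRatchetRelaySolvabilityLimit WakeRatchetRelayDecay WakeRatchetRelayDrainDirection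
  WakeRatchetRelayBorderedGeneral WakeRatchetRelaySolvabilityExplicit

/-! ## Quantitative transversality in the drain direction -/

/-- `Σ_m c_m/(2^m+2) ≤ −39/1000`. [folklore] -/
theorem drain_tsum_le :
    ∑' m : ℕ, (∏ i ∈ Finset.range m, ((-4 : ℝ) / (2 ^ (i + 1) - 1))) * (1 / (2 ^ m + 2)) ≤ -39 / 1000 := by
  rw [← summable_drain_term.sum_add_tsum_nat_add 6, drain_head_six_eq]
  have htail := drain_tail_six_abs_le
  rw [Real.norm_eq_abs] at htail
  have := (abs_le.1 htail).2
  norm_num at this ⊢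
  linarith

/-- **`∫_{(−∞,0]} w₁(t)·8e^{3t} dt ≤ −3/10`** (so `|ℓ_δ| ≥ 3/10`). [folklore] -/
theorem drain_functional_le :
    ∫ t in Iic (0 : ℝ), (∑' m : ℕ, (∏ i ∈ Finset.range m, ((-4 : ℝ) / (2 ^ (i + 1) - 1))) *
        Real.exp ((2 ^ m - 1) * t)) * (8 * Real.exp (3 * t)) ≤ -3 / 10 := by
  have hfun : (fun t : ℝ => (∑' m : ℕ, (∏ i ∈ Finset.range m, ((-4 : ℝ) / (2 ^ (i + 1) - 1))) *
        Real.exp ((2 ^ m - 1) * t)) * (8 * Real.exp (3 * t))) = fun t : ℝ => 8 * ((∑' m : ℕ,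
        (∏ i ∈ Finset.range m, ((-4 : ℝ) / (2 ^ (i + 1) - 1))) * Real.exp ((2 ^ m - 1) * t)) *
          Real.exp (3 * t)) := by
    funext t; ring
  rw [hfun, integral_const_mul, drain_functional_eq_tsum]
  have := drain_tsum_le
  linarith

/-! ## Weighted forcing: integrals -/

variable {φ : ℝ → ℝ} {A : ℝ}

/-- `|φ| ≤ Ae^{t/2}` on `t ≤ 0` ⇒ `φ` integrable on `(−∞,0]` with `∫|φ| ≤ 2A` (given measurability via
continuity). [folklore] -/
theorem weighted_integrable (hφ : Continuous φ) (hA : ∀ t : ℝ, t ≤ 0 → |φ t| ≤ A * Real.exp (t / 2)) :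
    IntegrableOn φ (Iic 0) ∧ ∫ t in Iic (0 : ℝ), |φ t| ≤ 2 * A := by
  have hmaj : IntegrableOn (fun t : ℝ => A * Real.exp ((1 / 2) * t)) (Iic 0) :=
    (integrableOn_exp_mul_Iic (by norm_num : (0 : ℝ) < 1 / 2) 0).const_mul A
  have hle : ∀ t ∈ Iic (0 : ℝ), ‖φ t‖ ≤ A * Real.exp ((1 / 2) * t) := fun t ht => by
    rw [Real.norm_eq_abs, show (1 : ℝ) / 2 * t = t / 2 by ring]; exact hA t ht
  have hint : IntegrableOn φ (Iic 0) :=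
    Integrable.mono' hmaj (hφ.aestronglyMeasurable.restrict)
      ((ae_restrict_iff' measurableSet_Iic).2 (Eventually.of_forall hle))
  refine ⟨hint, ?_⟩
  have habs : IntegrableOn (fun t : ℝ => |φ t|) (Iic 0) := hint.abs
  calc ∫ t in Iic (0 : ℝ), |φ t| ≤ ∫ t in Iic (0 : ℝ), A * Real.exp ((1 / 2) * t) :=
        setIntegral_mono_on habs hmaj measurableSet_Iic (fun t ht => by
          rw [← Real.norm_eq_abs]; exact hle t ht)
    _ = 2 * A := by
        rw [integral_const_mul, integral_exp_mul_Iic_zero (by norm_num : (0 : ℝ) < 1 / 2)]; ring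

/-- `|∫ w₁ φ| ≤ 71·∫|φ| ≤ 142A`. [folklore] -/
theorem adjoint_pairing_abs_le (hφ : Continuous φ) (hA : ∀ t : ℝ, t ≤ 0 → |φ t| ≤ A * Real.exp (t / 2)) :
    |∫ t in Iic (0 : ℝ), (∑' m : ℕ, (∏ i ∈ Finset.range m, ((-4 : ℝ) / (2 ^ (i + 1) - 1))) *
        Real.exp ((2 ^ m - 1) * t)) * φ t| ≤ 142 * A := by
  set W : ℝ → ℝ := fun t : ℝ => ∑' m : ℕ,
      (∏ i ∈ Finset.range m, ((-4 : ℝ) / (2 ^ (i + 1) - 1))) * Real.exp ((2 ^ m - 1) * t) with hW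
  obtain ⟨hint, hF⟩ := weighted_integrable hφ hA
  have hWcont : ContinuousOn W (Iic 0) := adjoint_continuousOn
  have hprod : IntegrableOn (fun t : ℝ => W t * φ t) (Iic 0) :=
    Integrable.bdd_mul (c := 71) hint (hWcont.aestronglyMeasurable measurableSet_Iic)
      ((ae_restrict_iff' measurableSet_Iic).2 (Eventually.of_forall fun t ht => by
        rw [Real.norm_eq_abs]; exact adjoint_abs_le ht))
  have hmaj : IntegrableOn (fun t : ℝ => 71 * |φ t|) (Iic 0) := hint.abs.const_mul 71
  calc |∫ t in Iic (0 : ℝ), W t * φ t| ≤ ∫ t in Iic (0 : ℝ), ‖W t * φ t‖ := by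
        rw [← Real.norm_eq_abs]; exact norm_integral_le_integral_norm _
    _ ≤ ∫ t in Iic (0 : ℝ), 71 * |φ t| :=
        setIntegral_mono_on hprod.norm hmaj measurableSet_Iic (fun t ht => by
          rw [norm_mul, Real.norm_eq_abs, Real.norm_eq_abs]
          exact mul_le_mul_of_nonneg_right (adjoint_abs_le ht) (abs_nonneg _))
    _ = 71 * ∫ t in Iic (0 : ℝ), |φ t| := integral_const_mul _ _
    _ ≤ 142 * A := by linarith

/-! ## The operator bound -/

/-- **EXPLICIT BOUND FOR THE DRAIN-BORDERED INVERSE.**  For `φ` continuous with `|φ(t)| ≤ Ae^{t/2}` on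
`t ≤ 0` there are `ε ∈ ℝ` and `h : ℝ → ℝ` (continuous, `h(0) = 0`, `h → 0` at `−∞`) with
`h' = 2e^{t/2}h(t/2) + φ − ε·8e^{3t}` on `t < 0` and the explicit bounds
`|ε| ≤ 474·A`, `|h(t)| ≤ 510000·A·e^{t/2}`, `|2e^{t/2}h(t/2) + (φ(t) − ε·8e^{3t})| ≤ 1100000·A·e^{t/2}`
(`t ≤ 0`).  (The pair is unique in the bounded normalised class: `drain_bordered_unique`.)
[cite: Tao2016AveragedNS, §1.2 (dyadic model); cell vocabulary (drain-bordered linearisation at the relay profile; programme R-lac, assembly)] -/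
theorem drain_bordered_inverse_bound (hφ : Continuous φ)
    (hA : ∀ t : ℝ, t ≤ 0 → |φ t| ≤ A * Real.exp (t / 2)) :
    ∃ ε : ℝ, ∃ h : ℝ → ℝ, Continuous h ∧ h 0 = 0 ∧ Tendsto h atBot (𝓝 0) ∧
      (∀ t : ℝ, t < 0 → HasDerivAt h
        (2 * Real.exp (t / 2) * h (t / 2) + (φ t - ε * (8 * Real.exp (3 * t)))) t) ∧
      |ε| ≤ 474 * A ∧
      (∀ t : ℝ, t ≤ 0 → |h t| ≤ 510000 * A * Real.exp (t / 2)) ∧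
      (∀ t : ℝ, t ≤ 0 → |2 * Real.exp (t / 2) * h (t / 2) + (φ t - ε * (8 * Real.exp (3 * t)))| ≤
        1100000 * A * Real.exp (t / 2)) := by
  have hA0 : 0 ≤ A := by
    have := hA 0 le_rfl
    rw [zero_div, Real.exp_zero, mul_one] at this
    exact (abs_nonneg _).trans this
  obtain ⟨hint, hF⟩ := weighted_integrable hφ hA
  have hAbd : ∀ s : ℝ, s ≤ 0 → |φ s| ≤ A := fun s hs =>
    (hA s hs).trans (by
      have : Real.exp (s / 2) ≤ 1 := Real.exp_le_one_iff.2 (by linarith)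
      nlinarith)
  -- the bordered solution
  obtain ⟨ε, h, hεdef, hc, h0, hde, ⟨B, hB⟩, hlim⟩ := drain_bordered_exists hφ hAbd hint
  -- bound on `ε`
  have hε : |ε| ≤ 474 * A := by
    rw [hεdef, abs_div]
    have hnum := adjoint_pairing_abs_le hφ hA
    have hden : 3 / 10 ≤ |∫ t in Iic (0 : ℝ), (∑' m : ℕ, (∏ i ∈ Finset.range m,
        ((-4 : ℝ) / (2 ^ (i + 1) - 1))) * Real.exp ((2 ^ m - 1) * t)) * (8 * Real.exp (3 * t))| := by
      have := drain_functional_le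
      rw [abs_of_neg (by linarith)]
      linarith
    rw [div_le_iff₀ (by linarith)]
    nlinarith
  -- the modified forcing `φ − ε·8e^{3t}` is in the weighted class with constant `A' = A + 8|ε|`
  set A' : ℝ := A + 8 * |ε| with hA'
  have hA'0 : 0 ≤ A' := by positivity
  have hfs_cont : Continuous (fun t : ℝ => φ t - ε * (8 * Real.exp (3 * t))) := by fun_prop
  have hfsA : ∀ t : ℝ, t ≤ 0 → |φ t - ε * (8 * Real.exp (3 * t))| ≤ A' * Real.exp (1 / 2 * t) := by
    intro t ht
    have h3 : Real.exp (3 * t) ≤ Real.exp (1 / 2 * t) := Real.exp_le_exp.2 (by linarith)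
    rw [show (1 : ℝ) / 2 * t = t / 2 by ring] at h3 ⊢
    calc |φ t - ε * (8 * Real.exp (3 * t))| ≤ |φ t| + |ε * (8 * Real.exp (3 * t))| := abs_sub _ _
      _ = |φ t| + 8 * |ε| * Real.exp (3 * t) := by
          rw [abs_mul, abs_mul, abs_of_pos (Real.exp_pos _), show |(8 : ℝ)| = 8 by norm_num]; ring
      _ ≤ A * Real.exp (t / 2) + 8 * |ε| * Real.exp (t / 2) :=
          add_le_add (hA t ht) (mul_le_mul_of_nonneg_left h3 (by positivity))
      _ = A' * Real.exp (t / 2) := by rw [hA']; ring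
  have hfsA' : ∀ t : ℝ, t ≤ 0 → |φ t - ε * (8 * Real.exp (3 * t))| ≤ A' * Real.exp (t / 2) := by
    intro t ht; have := hfsA t ht; rwa [show (1 : ℝ) / 2 * t = t / 2 by ring] at this
  obtain ⟨hfs_int, hFs⟩ := weighted_integrable hfs_cont hfsA'
  have hfs_bd : ∀ s : ℝ, s ≤ 0 → |φ s - ε * (8 * Real.exp (3 * s))| ≤ A' := fun s hs =>
    (hfsA' s hs).trans (by
      have : Real.exp (s / 2) ≤ 1 := Real.exp_le_one_iff.2 (by linarith)
      nlinarith)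
  -- an explicitly bounded solution of the same problem; by uniqueness it is `h`
  obtain ⟨h₂, hc₂, h0₂, hde₂, hB₂, hlim₂⟩ :=
    pantograph_inhom_exists_explicit_bounded hfs_cont hfs_bd hfs_int
  -- `h₂ → 0`: its limit `−∫ w₁ (φ − ε g)` vanishes by the choice of `ε` — easier: compare with `h` via
  -- uniqueness of the inhomogeneous problem (same value at `0`)
  have heq : ∀ t : ℝ, t ≤ 0 → h t = h₂ t :=
    WakeRatchetRelaySolvability.pantograph_inhom_unique hc.continuousOn hc₂.continuousOn hde hde₂
      (by rw [h0, h0₂])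
  -- boundedness constant for `h`
  set B₂ : ℝ := 16 * (A' / (Real.exp 1 - 2)) + 5 * ∫ s in Iic (0 : ℝ), |φ s - ε * (8 * Real.exp (3 * s))|
    with hB₂def
  have hBh : ∀ t : ℝ, t ≤ 0 → |h t| ≤ B₂ := fun t ht => by rw [heq t ht]; exact hB₂ t ht
  have he2 : 0 < Real.exp 1 - 2 := exp_one_sub_two_pos
  have he7 : (7 : ℝ) / 10 ≤ Real.exp 1 - 2 := by have := Real.exp_one_gt_d9; linarith
  have hB₂le : B₂ ≤ 33 * A' := by
    have h1 : A' / (Real.exp 1 - 2) ≤ A' / (7 / 10) := div_le_div_of_nonneg_left hA'0 (by norm_num) he7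
    rw [hB₂def]
    nlinarith
  -- decay rate with `γ = 1/2`
  have hdec := fun t (ht : t ≤ 0) => pantograph_decay (γ := 1 / 2) (by norm_num) le_rfl hfsA hfs_int
    hc.continuousOn hde hBh hlim ht
  have hdec' := fun t (ht : t ≤ 0) => pantograph_deriv_decay (γ := 1 / 2) (by norm_num) le_rfl hfsA
    hfs_int hc.continuousOn hde hBh hlim ht
  -- numerical consolidation: `A' ≤ A + 8·474A = 3793A`, `4B₂ + 2A' ≤ 134A'`
  have hA'le : A' ≤ 3793 * A := by rw [hA']; linarith
  refine ⟨ε, h, hc, h0, hlim, hde, hε, fun t ht => ?_, fun t ht => ?_⟩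
  · have := hdec t ht
    rw [show (1 : ℝ) / 2 * t = t / 2 by ring] at this
    have hK : (4 * B₂ + A' / (1 / 2)) ≤ 510000 * A := by
      have e : A' / (1 / 2) = 2 * A' := by ring
      rw [e]; linarith [hB₂le, hA'le]
    calc |h t| ≤ (4 * B₂ + A' / (1 / 2)) * Real.exp (t / 2) := this
      _ ≤ 510000 * A * Real.exp (t / 2) := mul_le_mul_of_nonneg_right hK (Real.exp_pos _).le
  · have := hdec' t ht
    rw [show (1 : ℝ) / 2 * t = t / 2 by ring] at this
    have hK : (2 * (4 * B₂ + A' / (1 / 2)) + A') ≤ 1100000 * A := by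
      have e : A' / (1 / 2) = 2 * A' := by ring
      rw [e]; linarith [hB₂le, hA'le]
    calc |2 * Real.exp (t / 2) * h (t / 2) + (φ t - ε * (8 * Real.exp (3 * t)))|
        ≤ (2 * (4 * B₂ + A' / (1 / 2)) + A') * Real.exp (t / 2) := this
      _ ≤ 1100000 * A * Real.exp (t / 2) := mul_le_mul_of_nonneg_right hK (Real.exp_pos _).le


/-! ## Appendix (appended): the inverse is linear/Lipschitz on the bounded normalised class

By uniqueness (`…RelayBorderedGeneral.drain_bordered_unique`) differences of bordered solutions are the
bordered solution for the difference forcing, so the explicit bound above applies to differences — the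
contraction input `‖M⁻¹(ψ₁ − ψ₂)‖ ≤ K‖ψ₁ − ψ₂‖` of the assembly. -/

/-- **LIPSCHITZ BOUND FOR THE DRAIN-BORDERED INVERSE.**  Let `φ₁, φ₂` be continuous with
`|φ₁(t) − φ₂(t)| ≤ A₁₂e^{t/2}` on `t ≤ 0`, and let `(h₁,ε₁)`, `(h₂,ε₂)` be bounded, normalised
(`hᵢ(0)=0`), decaying (`hᵢ → 0` at `−∞`) solutions, continuous on `(−∞,0]`, of
`hᵢ' = 2e^{t/2}hᵢ(t/2) + φᵢ − εᵢ·8e^{3t}` on `t < 0`.  Then `|ε₁−ε₂| ≤ 474A₁₂`,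
`|h₁(t)−h₂(t)| ≤ 510000·A₁₂e^{t/2}` and
`|2e^{t/2}(h₁−h₂)(t/2) + (φ₁−φ₂)(t) − (ε₁−ε₂)8e^{3t}| ≤ 1100000·A₁₂e^{t/2}` for `t ≤ 0`.
[cite: Tao2016AveragedNS, §1.2 (dyadic model); cell vocabulary (drain-bordered linearisation at the relay profile; programme R-lac, assembly)] -/
theorem drain_bordered_difference {φ₁ φ₂ h₁ h₂ : ℝ → ℝ} {ε₁ ε₂ A₁₂ B₁ B₂ : ℝ}
    (hφ₁ : Continuous φ₁) (hφ₂ : Continuous φ₂)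
    (hA : ∀ t : ℝ, t ≤ 0 → |φ₁ t - φ₂ t| ≤ A₁₂ * Real.exp (t / 2))
    (hc₁ : ContinuousOn h₁ (Iic 0)) (hc₂ : ContinuousOn h₂ (Iic 0))
    (hd₁ : ∀ t : ℝ, t < 0 → HasDerivAt h₁
      (2 * Real.exp (t / 2) * h₁ (t / 2) + (φ₁ t - ε₁ * (8 * Real.exp (3 * t)))) t)
    (hd₂ : ∀ t : ℝ, t < 0 → HasDerivAt h₂
      (2 * Real.exp (t / 2) * h₂ (t / 2) + (φ₂ t - ε₂ * (8 * Real.exp (3 * t)))) t)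
    (hB₁ : ∀ t : ℝ, t ≤ 0 → |h₁ t| ≤ B₁) (hB₂ : ∀ t : ℝ, t ≤ 0 → |h₂ t| ≤ B₂)
    (h0₁ : h₁ 0 = 0) (h0₂ : h₂ 0 = 0)
    (hl₁ : Tendsto h₁ atBot (𝓝 0)) (hl₂ : Tendsto h₂ atBot (𝓝 0)) :
    |ε₁ - ε₂| ≤ 474 * A₁₂ ∧
      (∀ t : ℝ, t ≤ 0 → |h₁ t - h₂ t| ≤ 510000 * A₁₂ * Real.exp (t / 2)) ∧
      (∀ t : ℝ, t ≤ 0 → |2 * Real.exp (t / 2) * (h₁ (t / 2) - h₂ (t / 2)) +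
        ((φ₁ t - φ₂ t) - (ε₁ - ε₂) * (8 * Real.exp (3 * t)))| ≤ 1100000 * A₁₂ * Real.exp (t / 2)) := by
  -- the explicitly bounded bordered solution for the difference forcing
  obtain ⟨ε, h, hc, h0, hlim, hde, hε, hh, hh'⟩ :=
    drain_bordered_inverse_bound (φ := fun t => φ₁ t - φ₂ t) (hφ₁.sub hφ₂) hA
  -- the difference pair solves the same bordered problem
  set d : ℝ → ℝ := fun t => h₁ t - h₂ t with hd_def
  have hdc : ContinuousOn d (Iic 0) := hc₁.sub hc₂
  have hdd : ∀ t : ℝ, t < 0 → HasDerivAt d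
      (2 * Real.exp (t / 2) * d (t / 2) + ((φ₁ t - φ₂ t) - (ε₁ - ε₂) * (8 * Real.exp (3 * t)))) t := by
    intro t ht
    refine ((hd₁ t ht).sub (hd₂ t ht)).congr_deriv ?_
    simp only [hd_def]; ring
  have hdB : ∀ t : ℝ, t ≤ 0 → |d t| ≤ B₁ + B₂ := fun t ht => by
    simp only [hd_def]; exact (abs_sub _ _).trans (add_le_add (hB₁ t ht) (hB₂ t ht))
  have hd0 : d 0 = 0 := by simp [hd_def, h0₁, h0₂]
  have hdl : Tendsto d atBot (𝓝 0) := by simpa using hl₁.sub hl₂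
  -- bound for `h` on the half-line (needed by uniqueness)
  have hA0 : 0 ≤ A₁₂ := by
    have := hA 0 le_rfl
    rw [zero_div, Real.exp_zero, mul_one] at this
    exact (abs_nonneg _).trans this
  have hhB : ∀ t : ℝ, t ≤ 0 → |h t| ≤ 510000 * A₁₂ := fun t ht =>
    (hh t ht).trans (by
      have : Real.exp (t / 2) ≤ 1 := Real.exp_le_one_iff.2 (by linarith)
      nlinarith)
  -- uniqueness: `(d, ε₁−ε₂) = (h, ε)`
  obtain ⟨hεeq, hdeq⟩ := drain_bordered_unique (f := fun t => φ₁ t - φ₂ t) hdc hc.continuousOn hdd hde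
    hdB hhB hd0 h0 hdl hlim
  refine ⟨by rw [hεeq]; exact hε, fun t ht => ?_, fun t ht => ?_⟩
  · have := hdeq t ht
    simp only [hd_def] at this
    rw [this]; exact hh t ht
  · have h1 := hdeq t ht
    have h2 := hdeq (t / 2) (by linarith)
    simp only [hd_def] at h1 h2
    rw [h2, hεeq]
    exact hh' t ht

end WakeRatchetRelayInverseBound

end Summit.NavierStokesRegularity.NavierStokesRegularity.Theorems

end
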